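import Summits.BirchSwinnertonDyer.BirchSwinnertonDyer.Theorems.BiquadraticEisensteinDescentEisensteinHeartFlatCMInertBadKPrimeSqrtEndomorphism
import Summits.BirchSwinnertonDyer.BirchSwinnertonDyer.Theorems.PrintCFramSqrtEndomorphismOnLeaf
import HarnessLib

set_option linter.dupNamespace false -- `Summit.BirchSwinnertonDyer.BirchSwinnertonDyer.Theorems.…` (summit = sub)
set_option autoImplicit false

/-!
# Crux `EisensteinHeartFlatCMInertBadKPrime` (stmt-BirchSwinnertonDyer-21341), line `hsieh-lambda`, layer 2 — `[√d_K]` in Galois-action form on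
# `E_K(K̄)` for EVERY CM curve `E/ℚ` with `j(E)` one of the seven certified `j`-invariants and every field `K ∌ √d_K` of characteristic `0`

Route `BiquadraticEisensteinDescent` (cell `pub/bsd-wall`, width-prover seat `bsd-wall-cm-bed-w1` g5). Sign-form companion of the tree's
`…Theorems.PrintCFram.SqrtEndomorphism` (which needs `√d ∈ K` and produces a `Γ_K`-equivariant `[√d]`): here `√d ∉ K` (the BED situation
`K = K′ ≠ K_CM`), and the output is an additive `ψ` on `E_K(K̄)` with `σ • ψ P = ψ (σ • P)` for `σ √d = √d`, `σ • ψ P = -ψ (σ • P)` for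
`σ √d = -√d`, and `ψ ∘ ψ = [d]` — the input of `…CMDatumAdapter.heartShape_xac_of_sqrt_endomorphism`.

* §1 `exists_sqrt_endomorphism_of_cert` — from a checked CM twist certificate (`DeuringCert.IsCMTwistCert c d`) on the certified model over `K`
  (`…SqrtEndomorphism.exists_sqrt_endomorphism` + `deg U = -d`);
* §2 `conj_untwist_smul_of_comm`, `conj_untwist_smul_of_anticomm`, `exists_endomorphism_of_j_eq` — transport to EVERY elliptic `V/K` with
  `j(V) = j(E)` (`j ≠ 0, 1728`): `V ≅_K E^{(D)}` (tree `exists_variableChange_eq_quadraticTwist_of_j_eq`, `Rubin1987.exists_isogeny_bijective_of_smul_eq`)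
  and `E^{(D)}(K̄) ≅ E(K̄)` over `K̄` (tree `untwistEquiv`, whose own signs `σ √D / √D` cancel);
* §3 `exists_endomorphism_of_cert` (§1 + §2);
* §4 **`exists_sqrt_endomorphism_of_j_mem`** — for `W/ℚ` with `W.j ∈ {-3375, 16581375, -32768, -884736, -884736000, -147197952000,
  -262537412640768000}` (`d_K = -7, -7, -11, -19, -43, -67, -163`), any field `K` of characteristic `0`, `r ∈ K̄` with `r² = d_K`, and
  `σ₀ ∈ Γ_K` with `σ₀ r = -r`: `ψ` on `(W.baseChange K)(K̄)` with the two Galois rules and `ψ (ψ P) = d_K • P`, `d_K = cmFieldDiscrOfJ W.j`.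
  NOT covered (no twist certificate / no quadratic-twist transport in the tree): `j = 0, 1728` (sextic/quartic twists), `j = 54000, -12288000,
  287496, 8000` (orders `-12, -27, -16, -8`).

THEOREMS ONLY (no definition, no named fact, no instance, no `sorry`); nothing about V2/V4 or any case of BSD is asserted; BSD is not proved by any of
this. Supports stmt-BirchSwinnertonDyer-21341 as a helper.

References: [SilvermanAdvancedTopics1994] II §2 Prop. II.2.3.1, Thm. II.2.2(b), App. A §3; [SilvermanAEC2009] III.4.8, Cor. III.6.3, X.5 Prop. 5.4;
[CremonaAlgorithms1997] §3.9.
-/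

noncomputable section

open scoped Classical

open Polynomial WeierstrassCurve Field
  Literature.NumberTheory.EllipticCurves
  Literature.NumberTheory.EllipticCurves.PolyCert
  Literature.NumberTheory.EllipticCurves.CMIsogenyCert
  Literature.NumberTheory.EllipticCurves.DeuringModels
  Literature.NumberTheory.EllipticCurves.Rank1Residual
  Summit.BirchSwinnertonDyer.BirchSwinnertonDyer.Theorems.PrintCFram.SqrtEndomorphism
  Summit.BirchSwinnertonDyer.BirchSwinnertonDyer.Theorems.BiquadraticEisensteinDescentEisensteinHeartFlatCMInertBadKPrimeSqrtEndomorphism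

namespace Summit.BirchSwinnertonDyer.BirchSwinnertonDyer.Theorems.BiquadraticEisensteinDescentEisensteinHeartFlatCMInertBadKPrimeSqrtEndomorphismTwist

/-! ## §1 The engine on the certified model, sign form -/

section Engine

variable {c : IsogenyCert} {d : ℤ}

/-- **`[√d]` on the certified model `E_c ⊗ K` over `K ∌ √d`, sign form.** For a checked CM twist certificate `c` (`IsCMTwistCert c d`), a field `K`
of characteristic `0`, `r ∈ K̄` with `r² = d`, `r ≠ 0`, and `σ₀ ∈ Γ_K` with `σ₀ r = -r`: an additive `ψ` on `E_c(K̄)` commuting with the `σ` fixing `r`,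
anti-commuting with the `σ` negating `r`, and with `ψ ∘ ψ = [d]`. [cite: SilvermanAdvancedTopics1994, II §2, Prop. II.2.3.1]
[cite: SilvermanAEC2009, Cor. III.6.3] -/
theorem exists_sqrt_endomorphism_of_cert (hc : c.check = true) (H : DeuringCert.IsCMTwistCert c d)
    (cop : CoprimeCert) {k' : ℕ} (hcop : c.checkCoprime cop k' = true) (hℓ : cop.ℓ.Prime)
    {K : Type} [Field K] [CharZero K] (r : AlgebraicClosure K) (hr : r ^ 2 = algebraMap K (AlgebraicClosure K) (d : K)) (hr0 : r ≠ 0)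
    (σ₀ : absoluteGaloisGroup K) (hσ₀ : σ₀ • r = -r)
    [hE : ((DeuringCert.curve c).map (Int.castRingHom K)).IsElliptic] :
    ∃ ψ : ((DeuringCert.curve c).map (Int.castRingHom K)).geomPoints →+ ((DeuringCert.curve c).map (Int.castRingHom K)).geomPoints,
      (∀ σ : absoluteGaloisGroup K, σ • r = r → ∀ P, σ • ψ P = ψ (σ • P)) ∧
      (∀ σ : absoluteGaloisGroup K, σ • r = -r → ∀ P, σ • ψ P = -ψ (σ • P)) ∧
      (∀ P, ψ (ψ P) = d • P) := by
  set E := (DeuringCert.curve c).map (Int.castRingHom K) with hEdef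
  set E' := (DeuringCert.curve' c).map (Int.castRingHom K) with hE'def
  let φ : IsogenyFormula E E' := c.toFormula hc E E' rfl rfl
  have HK : φ.IsTwistBy (d : K) :=
    { a₁ := by change (Int.castRingHom K) c.a₁ = 0; rw [H.a₁, map_zero]
      a₂ := by change (Int.castRingHom K) c.a₂ = 0; rw [H.a₂, map_zero]
      a₃ := by change (Int.castRingHom K) c.a₃ = 0; rw [H.a₃, map_zero]
      a₁' := by change (Int.castRingHom K) c.a₁' = 0; rw [H.a₁', map_zero]
      a₂' := by change (Int.castRingHom K) c.a₂' = 0; rw [H.a₂', map_zero]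
      a₃' := by change (Int.castRingHom K) c.a₃' = 0; rw [H.a₃', map_zero]
      a₄' := by
        change (Int.castRingHom K) c.a₄' = _ * (Int.castRingHom K) c.a₄
        rw [H.a₄', map_mul, map_pow, eq_intCast]
      a₆' := by
        change (Int.castRingHom K) c.a₆' = _ * (Int.castRingHom K) c.a₆
        rw [H.a₆', map_mul, map_pow, eq_intCast]
      T := by change (ofList c.T : K[X]) = 0; rw [H.T]; rfl }
  have hU : φ.U = (ofList c.U : K[X]) := rfl
  have hh : φ.h = (ofList c.h : K[X]) := rfl
  have hcopK : IsCoprime φ.U φ.h := by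
    rw [hU, hh]; exact IsogenyCert.isCoprime_of_checkCoprime hcop hℓ K
  have hdegU : (φ.U.natDegree : ℤ) = -d := by
    rw [hU, IsogenyCert.natDegree_ofList_eq c.U (by rw [H.U_top]; exact one_ne_zero)]
    exact H.deg
  obtain ⟨ψ, h1, h2, h3⟩ := exists_sqrt_endomorphism φ HK hcopK r hr hr0 σ₀ hσ₀
  exact ⟨ψ, h1, h2, fun P ↦ by rw [h3, hdegU, neg_smul, neg_neg]⟩

end Engine

/-! ## §2 Transport along `V ≅_K E^{(D)} ≅_{K̄} E` with signs -/

section Transport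

variable {K : Type} [Field K] [CharZero K] {E : WeierstrassCurve K} [E.IsElliptic] [E.IsCharNeTwoNF]

omit [E.IsElliptic] in
/-- Conjugating by `ι : E^{(D)}(K̄) ≃ E(K̄)` preserves commutation with `σ` (the signs `σ √D / √D` of `ι` cancel). [cite: CremonaAlgorithms1997, §3.9] -/
theorem conj_untwist_smul_of_comm {D : K} (hD : D ≠ 0) (ψ : E.geomPoints →+ E.geomPoints) (σ : absoluteGaloisGroup K)
    (hψσ : ∀ P : E.geomPoints, σ • ψ P = ψ (σ • P)) (Q : (E.quadraticTwist D).geomPoints) :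
    σ • (untwistEquiv E hD).symm (ψ (untwistEquiv E hD Q)) = (untwistEquiv E hD).symm (ψ (untwistEquiv E hD (σ • Q))) := by
  rcases map_geomSqrt (show AlgebraicClosure K ≃ₐ[K] AlgebraicClosure K from σ) D with hσD | hσD
  · rw [untwistEquiv_smul_of_eq E hD σ hσD, ← hψσ, untwistEquiv_symm_smul_of_eq E hD σ hσD]
  · rw [untwistEquiv_smul_of_eq_neg E hD σ hσD, map_neg, ← hψσ, map_neg, untwistEquiv_symm_smul_of_eq_neg E hD σ hσD, neg_neg]

omit [E.IsElliptic] in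
/-- Conjugating by `ι : E^{(D)}(K̄) ≃ E(K̄)` preserves ANTI-commutation with `σ`. [cite: CremonaAlgorithms1997, §3.9] -/
theorem conj_untwist_smul_of_anticomm {D : K} (hD : D ≠ 0) (ψ : E.geomPoints →+ E.geomPoints) (σ : absoluteGaloisGroup K)
    (hψσ : ∀ P : E.geomPoints, σ • ψ P = -ψ (σ • P)) (Q : (E.quadraticTwist D).geomPoints) :
    σ • (untwistEquiv E hD).symm (ψ (untwistEquiv E hD Q)) = -(untwistEquiv E hD).symm (ψ (untwistEquiv E hD (σ • Q))) := by
  have hψσ' : ∀ P : E.geomPoints, ψ (σ • P) = -(σ • ψ P) := fun P ↦ by rw [hψσ, neg_neg]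
  rcases map_geomSqrt (show AlgebraicClosure K ≃ₐ[K] AlgebraicClosure K from σ) D with hσD | hσD
  · rw [untwistEquiv_smul_of_eq E hD σ hσD, hψσ', map_neg, untwistEquiv_symm_smul_of_eq E hD σ hσD, neg_neg]
  · rw [untwistEquiv_smul_of_eq_neg E hD σ hσD, map_neg, hψσ', neg_neg, untwistEquiv_symm_smul_of_eq_neg E hD σ hσD, neg_neg]

/-- **Sign-form `[√d]` on EVERY elliptic `V/K` with `j(V) = j(E)`** (`j ≠ 0, 1728`): if `E/K` (`a₁ = a₃ = 0`) carries an additive `ψ` commuting with the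
`σ ∈ Γ_K` fixing `r`, anti-commuting with those negating `r`, with `ψ ∘ ψ = [d]`, then so does `V(K̄)`: `V ≅_K E^{(D)}` (Silverman *AEC* X.5.4) and
`f = e⁻¹ ι⁻¹ ψ ι e` for the `K`-isomorphism `e` and the `K̄`-isomorphism `ι = untwistEquiv`. [cite: SilvermanAEC2009, X.5 Prop. 5.4 and Cor. 5.4.1]
[cite: CremonaAlgorithms1997, §3.9 (p. 87)] -/
theorem exists_endomorphism_of_j_eq (h0 : E.j ≠ 0) (h1728 : E.j ≠ 1728) {d : ℤ} (r : AlgebraicClosure K)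
    (ψ : E.geomPoints →+ E.geomPoints)
    (hψU : ∀ σ : absoluteGaloisGroup K, σ • r = r → ∀ P, σ • ψ P = ψ (σ • P))
    (hψU' : ∀ σ : absoluteGaloisGroup K, σ • r = -r → ∀ P, σ • ψ P = -ψ (σ • P))
    (hψ2 : ∀ P, ψ (ψ P) = d • P)
    (V : WeierstrassCurve K) [V.IsElliptic] (hj : V.j = E.j) :
    ∃ f : V.geomPoints →+ V.geomPoints,
      (∀ σ : absoluteGaloisGroup K, σ • r = r → ∀ P, σ • f P = f (σ • P)) ∧
      (∀ σ : absoluteGaloisGroup K, σ • r = -r → ∀ P, σ • f P = -f (σ • P)) ∧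
      (∀ P, f (f P) = d • P) := by
  haveI : NeZero (2 : K) := ⟨two_ne_zero⟩
  obtain ⟨D, hD, C, hC⟩ := exists_variableChange_eq_quadraticTwist_of_j_eq hj h0 h1728
  obtain ⟨ι, hι⟩ := Rubin1987.exists_isogeny_bijective_of_smul_eq C hC
  let e : V.geomPoints ≃+ (E.quadraticTwist D).geomPoints := AddEquiv.ofBijective ι.toAddMonoidHom hι
  have he : ∀ Q, e Q = ι Q := fun _ ↦ rfl
  have heσ : ∀ (σ : absoluteGaloisGroup K) (Q : V.geomPoints), e (σ • Q) = σ • e Q :=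
    fun σ Q ↦ by rw [he, he, ι.map_smul]
  have heσ' : ∀ (σ : absoluteGaloisGroup K) (Y : (E.quadraticTwist D).geomPoints), e.symm (σ • Y) = σ • e.symm Y := fun σ Y ↦ by
    apply e.injective; rw [e.apply_symm_apply, heσ, e.apply_symm_apply]
  let u := untwistEquiv E hD
  let ψD : (E.quadraticTwist D).geomPoints →+ (E.quadraticTwist D).geomPoints :=
    u.symm.toAddMonoidHom.comp (ψ.comp u.toAddMonoidHom)
  have hψD : ∀ Q, ψD Q = u.symm (ψ (u Q)) := fun _ ↦ rfl
  refine ⟨e.symm.toAddMonoidHom.comp (ψD.comp e.toAddMonoidHom), fun σ hσ P ↦ ?_, fun σ hσ P ↦ ?_, fun P ↦ ?_⟩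
  · change σ • e.symm (ψD (e P)) = e.symm (ψD (e (σ • P)))
    rw [← heσ', hψD, hψD, conj_untwist_smul_of_comm hD ψ σ (hψU σ hσ), heσ]
  · change σ • e.symm (ψD (e P)) = -e.symm (ψD (e (σ • P)))
    rw [← heσ', hψD, hψD, conj_untwist_smul_of_anticomm hD ψ σ (hψU' σ hσ), heσ, map_neg]
  · change e.symm (ψD (e (e.symm (ψD (e P))))) = d • P
    rw [e.apply_symm_apply, hψD, hψD, AddEquiv.apply_symm_apply, hψ2, map_zsmul, AddEquiv.symm_apply_apply, map_zsmul,
      e.symm_apply_apply]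

end Transport

/-! ## §3 From a certificate to every curve with the model's `j`-invariant -/

section Cert

/-- **From a certificate to every curve with the model's `j`-invariant, sign form** (§1 + §2). [cite: SilvermanAdvancedTopics1994, II §2,
Prop. II.2.3.1 and Thm. II.2.2(b)] -/
theorem exists_endomorphism_of_cert {c : IsogenyCert} {d : ℤ} (hc : c.check = true)
    (H : DeuringCert.IsCMTwistCert c d) (cop : CoprimeCert) {k' : ℕ}
    (hcop : c.checkCoprime cop k' = true) (hℓ : cop.ℓ.Prime) {n : ℤ}
    (hmodel : (DeuringCert.curve c).c₄ ^ 3 = n * (DeuringCert.curve c).Δ)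
    (hΔ : (DeuringCert.curve c).Δ ≠ 0) (hn0 : n ≠ 0) (hn1728 : n ≠ 1728)
    {K : Type} [Field K] [CharZero K] (r : AlgebraicClosure K) (hr : r ^ 2 = algebraMap K (AlgebraicClosure K) (d : K)) (hr0 : r ≠ 0)
    (σ₀ : absoluteGaloisGroup K) (hσ₀ : σ₀ • r = -r) (V : WeierstrassCurve K) [V.IsElliptic] (hj : V.j = (n : K)) :
    ∃ f : V.geomPoints →+ V.geomPoints,
      (∀ σ : absoluteGaloisGroup K, σ • r = r → ∀ P, σ • f P = f (σ • P)) ∧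
      (∀ σ : absoluteGaloisGroup K, σ • r = -r → ∀ P, σ • f P = -f (σ • P)) ∧
      (∀ P, f (f P) = d • P) := by
  haveI hE := isElliptic_map_intCast (DeuringCert.curve c) K hΔ
  haveI := isCharNeTwoNF_of_cert H K
  have hjE := j_map_intCast_of_c₄_pow (DeuringCert.curve c) K n hmodel
  obtain ⟨ψ, h1, h2, h3⟩ := exists_sqrt_endomorphism_of_cert hc H cop hcop hℓ r hr hr0 σ₀ hσ₀
  exact exists_endomorphism_of_j_eq (by rw [hjE]; exact_mod_cast hn0) (by rw [hjE]; exact_mod_cast hn1728) r ψ h1 h2 h3 V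
    (by rw [hj, hjE])

end Cert

/-! ## §4 The seven certified `j`-invariants -/

section Leaf

variable (W : WeierstrassCurve ℚ) [W.IsElliptic] {K : Type} [Field K] [CharZero K]

/-- **`[√d_K]` in sign form on `E_K(K̄)` for the seven certified CM `j`-invariants.** For `W/ℚ` with
`W.j ∈ {-3375, 16581375, -32768, -884736, -884736000, -147197952000, -262537412640768000}`, any field `K` of characteristic `0`, `r ∈ K̄` with
`r² = d_K = cmFieldDiscrOfJ W.j` (`∈ {-7, -11, -19, -43, -67, -163}`), `r ≠ 0`, and `σ₀ ∈ Γ_K` with `σ₀ r = -r` (i.e. `√d_K ∉ K`): an additive `ψ` on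
`(W ⊗ K)(K̄)` with `σ • ψ P = ψ (σ • P)` for `σ r = r`, `σ • ψ P = -ψ (σ • P)` for `σ r = -r`, and `ψ (ψ P) = d_K • P`. Case by case from the tree's
certificates `cert7, cert28, cert11, cert19, cert43, cert67, cert163`. [cite: SilvermanAdvancedTopics1994, II §2 Thm. 2.2(b), Prop. 2.3.1 and App. A §3] -/
theorem exists_sqrt_endomorphism_of_j_mem
    (hj : W.j = -3375 ∨ W.j = 16581375 ∨ W.j = -32768 ∨ W.j = -884736 ∨ W.j = -884736000 ∨ W.j = -147197952000 ∨
      W.j = -262537412640768000)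
    (r : AlgebraicClosure K) (hr : r ^ 2 = algebraMap K (AlgebraicClosure K) ((cmFieldDiscrOfJ W.j : ℤ) : K)) (hr0 : r ≠ 0)
    (σ₀ : absoluteGaloisGroup K) (hσ₀ : σ₀ • r = -r) :
    ∃ ψ : (W.baseChange K).geomPoints →+ (W.baseChange K).geomPoints,
      (∀ σ : absoluteGaloisGroup K, σ • r = r → ∀ P, σ • ψ P = ψ (σ • P)) ∧
      (∀ σ : absoluteGaloisGroup K, σ • r = -r → ∀ P, σ • ψ P = -ψ (σ • P)) ∧
      (∀ P, ψ (ψ P) = (cmFieldDiscrOfJ W.j) • P) := by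
  have hjK : (W.baseChange K).j = algebraMap ℚ K W.j := by simp only [baseChange, map_j]
  haveI : (W.baseChange K).IsElliptic := inferInstanceAs (W.map (algebraMap ℚ K)).IsElliptic
  rcases hj with h | h | h | h | h | h | h <;> rw [h] at hr hjK ⊢ <;> norm_num [cmFieldDiscrOfJ] at hr ⊢
  · -- j = -3375, d = -7
    exact exists_endomorphism_of_cert (IsogenyCert.check_of_checkFast checkFast_cert7)
      isCMTwistCert_cert7 cert7Cop checkCoprime_cert7 (by rw [show cert7Cop.ℓ = 10007 from rfl]; norm_num)
      model7.2 (by rw [model7.1]; norm_num) (by norm_num) (by norm_num) r (by rw [hr]; push_cast; ring) hr0 σ₀ hσ₀ (W.baseChange K)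
      (by rw [hjK]; norm_num)
  · -- j = 16581375, d = -7
    exact exists_endomorphism_of_cert (IsogenyCert.check_of_checkFast checkFast_cert28)
      isCMTwistCert_cert28 cert28Cop checkCoprime_cert28 (by rw [show cert28Cop.ℓ = 10007 from rfl]; norm_num)
      model28.2 (by rw [model28.1]; norm_num) (by norm_num) (by norm_num) r (by rw [hr]; push_cast; ring) hr0 σ₀ hσ₀ (W.baseChange K)
      (by rw [hjK]; norm_num)
  · -- j = -32768, d = -11
    exact exists_endomorphism_of_cert (IsogenyCert.check_of_checkFast checkFast_cert11)
      isCMTwistCert_cert11 cert11Cop checkCoprime_cert11 (by rw [show cert11Cop.ℓ = 10007 from rfl]; norm_num)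
      model11.2 (by rw [model11.1]; norm_num) (by norm_num) (by norm_num) r (by rw [hr]; push_cast; ring) hr0 σ₀ hσ₀ (W.baseChange K)
      (by rw [hjK]; norm_num)
  · -- j = -884736, d = -19
    exact exists_endomorphism_of_cert (IsogenyCert.check_of_checkFast checkFast_cert19)
      isCMTwistCert_cert19 cert19Cop checkCoprime_cert19 (by rw [show cert19Cop.ℓ = 10007 from rfl]; norm_num)
      model19.2 (by rw [model19.1]; norm_num) (by norm_num) (by norm_num) r (by rw [hr]; push_cast; ring) hr0 σ₀ hσ₀ (W.baseChange K)
      (by rw [hjK]; norm_num)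
  · -- j = -884736000, d = -43
    exact exists_endomorphism_of_cert (IsogenyCert.check_of_checkFast checkFast_cert43)
      isCMTwistCert_cert43 cert43Cop checkCoprime_cert43 (by rw [show cert43Cop.ℓ = 10007 from rfl]; norm_num)
      model43.2 (by rw [model43.1]; norm_num) (by norm_num) (by norm_num) r (by rw [hr]; push_cast; ring) hr0 σ₀ hσ₀ (W.baseChange K)
      (by rw [hjK]; norm_num)
  · -- j = -147197952000, d = -67
    exact exists_endomorphism_of_cert (IsogenyCert.check_of_checkFast checkFast_cert67)
      isCMTwistCert_cert67 cert67Cop checkCoprime_cert67 (by rw [show cert67Cop.ℓ = 10007 from rfl]; norm_num)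
      model67.2 (by rw [model67.1]; norm_num) (by norm_num) (by norm_num) r (by rw [hr]; push_cast; ring) hr0 σ₀ hσ₀ (W.baseChange K)
      (by rw [hjK]; norm_num)
  · -- j = -262537412640768000, d = -163
    exact exists_endomorphism_of_cert (IsogenyCert.check_of_checkFast checkFast_cert163)
      isCMTwistCert_cert163 cert163Cop checkCoprime_cert163 (by rw [show cert163Cop.ℓ = 10007 from rfl]; norm_num)
      model163.2 (by rw [model163.1]; norm_num) (by norm_num) (by norm_num) r (by rw [hr]; push_cast; ring) hr0 σ₀ hσ₀ (W.baseChange K)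
      (by rw [hjK]; norm_num)

end Leaf

end Summit.BirchSwinnertonDyer.BirchSwinnertonDyer.Theorems.BiquadraticEisensteinDescentEisensteinHeartFlatCMInertBadKPrimeSqrtEndomorphismTwist

end
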